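import Mathlib.Combinatorics.SetFamily.FourFunctions
import Mathlib.Tactic
import HarnessLib
import HarnessLib.Audit.Tags

/-!
# `NoHeavyLowerTail` (crux stmt-CriticalPhenomena-4575), master-family line P1 (gen 28):
# coloured Marica–Schönheim for two colours, part 1/3 — the six-letter TYPE SYSTEM and its finite lifting facts

Support file (seat `prim-masterthm-p1`, gen 28; `--supports stmt-CriticalPhenomena-4575`).  Definitions: the type alphabet `Ty` (`R` red, `B` blue,
`P` both, ghost types `U` = "red below / blue above", `D` its mirror, `N` absent), the credit tables `dT` (difference), `mT` (intersection), `jT` (union),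
`sT` (self), `pres`, and the projection maps `h₂` (single lift), `h₁` (double lift); all lifting facts are finite and proved by `decide`.
No `sorry`, standard axioms.  Parts 2/3 (`…SahiColouredMSLifts`) and 3/3 (`…SahiColouredMS`) carry the configurations and the theorem
`#A + #B ≤ #((A \\ A) ∪ (B \\ B) ∪ (A ⊼ B) ∪ (A ⊻ B))` for disjoint `A, B`.  Memo `run/shared/lean/prim/prim-masterthm/FROM-prim-masterthm-p1-g28-STRONG-DAYKIN.md` §9–§10 (typed Marica–Schönheim induction; the six-letter
system and the projection maps were found by the closure search `code-g28/typed/` and are checked here by the kernel). [this work]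
-/

namespace Summit.CriticalPhenomena.PercolationContinuityZ3.Theorems.SahiColouredMS

open Finset

/-! ### 1. The type alphabet, the credit tables, the projection maps -/

/-- Types: `R` red, `B` blue, `P` purple (both), `U`/`D` the two ghost types, `N` absent. [this work] -/
inductive Ty | R | B | P | U | D | N
  deriving DecidableEq, Fintype

open Ty

/-- Difference table: a point of type `σ` (as `z`) and one of type `τ` (as `w`) credit `z \ w`. [this work] -/
def dT : Ty → Ty → Bool
  | R, R | R, P | R, U => true
  | B, B | B, P | B, D => true
  | P, R | P, B | P, P | P, U | P, D => true
  | U, B | U, P | U, D => true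
  | D, R | D, P | D, U => true
  | _, _ => false

/-- Intersection table (`z ∩ w`). [this work] -/
def mT : Ty → Ty → Bool
  | R, B | R, P | R, U => true
  | B, R | B, P | B, D => true
  | P, R | P, B | P, P | P, U | P, D => true
  | U, R | U, P | U, D => true
  | D, B | D, P | D, U => true
  | _, _ => false

/-- Union table (`z ∪ w`). [this work] -/
def jT : Ty → Ty → Bool
  | R, B | R, P | R, D => true
  | B, R | B, P | B, U => true
  | P, R | P, B | P, P | P, U | P, D => true
  | U, B | U, P | U, D => true
  | D, R | D, P | D, U => true
  | _, _ => false

/-- Self-credit: `P, U, D` points credit themselves. [this work] -/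
def sT : Ty → Bool
  | P | U | D => true
  | _ => false

/-- Present types. [this work] -/
def pres : Ty → Bool
  | N => false
  | _ => true

/-- The single-lift projection `h₂ (type of s) (type of insert a s)`. [this work] -/
def h₂ : Ty → Ty → Ty
  | N, N => N
  | P, _ | _, P => P
  | R, B | B, R | U, D | D, U => P
  | R, R | R, N | N, R => R
  | B, B | B, N | N, B => B
  | U, U | U, N | N, U | R, U | B, U | U, R | U, B => U
  | D, D | D, N | N, D | R, D | B, D | D, R | D, B => D

/-- The double-lift projection `h₁ (type of s) (type of insert a s)` (absent unless both present). [this work] -/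
def h₁ : Ty → Ty → Ty
  | N, _ | _, N => N
  | R, R => R | R, B => U | R, P => U | R, U => U | R, D => R
  | B, R => D | B, B => B | B, P => D | B, U => B | B, D => D
  | P, R => D | P, B => U | P, P => P | P, U => U | P, D => D
  | U, R => R | U, B => U | U, P => U | U, U => U | U, D => R
  | D, R => D | D, B => B | D, P => D | D, U => B | D, D => D

/-! ### 2. The finite lifting facts (checked by `decide`) -/

/-- `h₂` is present iff one of the lifts is. [this work] -/
theorem pres_h₂ : ∀ x y : Ty, pres (h₂ x y) = (pres x || pres y) := by decide

/-- `h₁` is present iff both lifts are. [this work] -/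
theorem pres_h₁ : ∀ x y : Ty, pres (h₁ x y) = (pres x && pres y) := by decide

/-- Tables only credit present types. [this work] -/
theorem pres_of_table : ∀ x y : Ty, (dT x y = true ∨ mT x y = true ∨ jT x y = true) → pres x = true ∧ pres y = true := by decide

/-- Self credit only for present types. [this work] -/
theorem pres_of_sT : ∀ x : Ty, sT x = true → pres x = true := by decide

/-- Single lift of differences. [this work] -/
theorem liftD₂ : ∀ x y x' y' : Ty, dT (h₂ x y) (h₂ x' y') = true →
    (dT x x' = true ∨ dT x y' = true ∨ dT y x' = true ∨ dT y y' = true) := by decide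

/-- Single lift of intersections. [this work] -/
theorem liftM₂ : ∀ x y x' y' : Ty, mT (h₂ x y) (h₂ x' y') = true →
    (mT x x' = true ∨ mT x y' = true ∨ mT y x' = true ∨ mT y y' = true) := by decide

/-- Single lift of unions. [this work] -/
theorem liftJ₂ : ∀ x y x' y' : Ty, jT (h₂ x y) (h₂ x' y') = true →
    (jT x x' = true ∨ jT x y' = true ∨ jT y x' = true ∨ jT y y' = true) := by decide

/-- Single lift of self credits. [this work] -/
theorem liftS₂ : ∀ x y : Ty, sT (h₂ x y) = true →
    (sT x = true ∨ sT y = true ∨ mT x y = true ∨ mT y x = true ∨ jT x y = true ∨ jT y x = true) := by decide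

/-- Double lift of differences: a level-0 producer and the level-1 producer. [this work] -/
theorem liftD₁ : ∀ x y x' y' : Ty, dT (h₁ x y) (h₁ x' y') = true →
    (dT x x' = true ∨ dT x y' = true ∨ dT y y' = true) ∧ dT y x' = true := by decide

/-- Double lift of intersections. [this work] -/
theorem liftM₁ : ∀ x y x' y' : Ty, mT (h₁ x y) (h₁ x' y') = true →
    (mT x x' = true ∨ mT x y' = true ∨ mT y x' = true) ∧ mT y y' = true := by decide

/-- Double lift of unions. [this work] -/
theorem liftJ₁ : ∀ x y x' y' : Ty, jT (h₁ x y) (h₁ x' y') = true →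
    jT x x' = true ∧ (jT x y' = true ∨ jT y x' = true ∨ jT y y' = true) := by decide

/-- Double lift of self credits. [this work] -/
theorem liftS₁ : ∀ x y : Ty, sT (h₁ x y) = true →
    (sT x = true ∨ mT x y = true ∨ mT y x = true) ∧ (sT y = true ∨ jT x y = true ∨ jT y x = true) := by decide

end Summit.CriticalPhenomena.PercolationContinuityZ3.Theorems.SahiColouredMS
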